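import Summits.BirchSwinnertonDyer.BirchSwinnertonDyer.Theses.AdditiveKolyvaginRoad
import Summits.BirchSwinnertonDyer.BirchSwinnertonDyer.Theorems.AdditiveKolyvaginRoadKolyvaginPrimitiveAdditiveRankLowering
import Summits.BirchSwinnertonDyer.BirchSwinnertonDyer.Theorems.AdditiveKolyvaginRoadLevelSystems
import Summits.BirchSwinnertonDyer.BirchSwinnertonDyer.Theorems.AdditiveKolyvaginRoadLocalPackage
import Summits.BirchSwinnertonDyer.BirchSwinnertonDyer.Theorems.AdditiveKolyvaginRoadKolyvaginPrimitiveAdditiveInduction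

/-! v4 (tenure desk bsd-wall-add g6, 2026-08-27T15:2xZ) = v3 WITH STUB KS RE-CUT BY LOCAL TYPE. The lead's census on the parent
(akr-p1 g3, card v8 / NOTES ## Census: «KS is crux-sized (promote-stub); BOT belongs to the children») makes the parent's
type-free KS `stub_levelKolyvaginSystemsAdditive` the open mathematics above the bottom for EVERY additive type at once; on
this ABELIAN-TYPE child the line only needs it ON THE ABELIAN LOCUS, where the same untwisting mechanism that owns the bottom
(tame branch `g_ε = f_E ⊗ ε̄` of level `K₀(p)·M`, nebentypus `ε̄²`; crux ideas `twisted-brandt-bottom` / `hida-vertical-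
transport`) also owns Zhang's (A2) transport (Ihara ∕ multiplicity one at level `p¹` with nebentypus instead of the
`Γ₀(p²)`-anemic statement refuted on (5, II*)) and (A5) base case for the level-raised `g_n ⊗ ε̄`. Hence **KS-AB**
`stub_levelKolyvaginSystemsAbelianType` := v8's KS + the child's type binder `SubM W p ∨ SubGord W p` (same position as in the
child decl and in BC-v2); `inductionGivenRankLowering_of` carries the binder; P and LOC stay BYTE-IDENTICAL to the parent's v8
(type-free content: one proof closes them in the parent and in both children); ENGINE (p534939) and A1 (p521749) cited by name.
Effect: this child can CLOSE without the supercuspidal case (v3 held it hostage to the parent-strength KS). The parent's KS is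
recovered from KS-AB + the sibling's KS-NA by `Rank1Residual.Additive.sub_exhaustive`, exactly as glue 20420 recovers the
parent. Four stubs: P ∕ BC-v2 ∕ KS-AB ∕ LOC; `_of` sorry-free. -/

/-! v3 (tenure desk bsd-wall-add g5, 2026-08-27) = v2 RE-BASED ON THE PARENT'S v8 (Cruxes/KolyvaginPrimitiveAdditive/Lines/birth.lean commit 82668591ee93): stub ENGINE `stub_inductionOfLevelSystemsAdditive` is the LANDED theorem `Summit.BirchSwinnertonDyer.BirchSwinnertonDyer.Theorems.AdditiveKoly.stub_inductionOfLevelSystemsAdditive` (p534939), imported and cited BY NAME in `inductionGivenRankLowering_of`; the local sorried copy is removed. FOUR stubs remain: P (modulo PUB) / BC-v2 (open; this child's content: the abelian-type bottom) / KS (open) / LOC (provable; reduced by p533303 + p535599 + p536240 to (Perf) + (Supply)). Stub texts P/KS/LOC byte-identical to the parent's v8. -/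

/-!
# Crux `KolyvaginPrimitiveAdditiveAbelianType` (stmt-BirchSwinnertonDyer-20418) — birth skeleton v2 DRAFT (tenure desk
bsd-wall-add g4, 2026-08-27; STAGED — the registered skeleton of record is g3's v1 `Lines/birth.lean` (v5-shape:
BC · P · A1 · S2′); this v2 RE-BASES it on the lead's v7.1 shape and is to be published only on the lead's word or by
the next tenure generation: `ledger crux write stmt-BirchSwinnertonDyer-20418 Lines/birth.lean --file …` + skeleton check).

WHAT CHANGES vs v1 (g3): A1 `stub_rankLoweringAdditive` is LANDED (p511644 …, cited by name as in v7.1, no longer a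
stub); v1's S2′ `stub_inductionGivenRankLoweringAbelianType` is replaced by v7.1's THREE type-free stubs KS
`stub_levelKolyvaginSystemsAdditive` · LOC `stub_kolyvaginLocalPackageAdditive` · ENGINE
`stub_inductionOfLevelSystemsAdditive` (ENGINE LANDED for the parent, p534939 — same text closes it here; LOC reduced,
p533303) and the derived theorem `inductionGivenRankLowering_of`; P `stub_oddSelmerRankAdditive` verbatim. The bottom
keeps v1's cut with the binder order of v7.1: **BC-v2** `stub_baseCaseAbelianTypeV2` = v7.1's `stub_bottomRankOneAdditive`
+ binder `SubM W p ∨ SubGord W p` (Kolyvagin mod `p` in `p`-Selmer rank one on the abelian-type locus, witness pinned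
`n = 1`; SAME mathematical content as v1's `stub_baseCaseAbelianType`, hypotheses re-ordered to v7.1's — hence the new
name, the matcher being textual), to be re-cut S′ ∘ A′ ∘ B′ over the twisted definite datum (crux ideas
`twisted-brandt-bottom`, `hida-vertical-transport` under `Cruxes/KolyvaginPrimitiveAdditiveAbelianType/Ideas/`).
`_of` = v7.1's composition with the type hypothesis threaded (sorry-free; sorries only inside `stub_*`).
[cite: WZhang2014, Thm. 9.1, §7] [cite: arXiv:2410.23241, Prop. 3.1.3] [cite: BertoliniDarmon2005, Thm. 3.2, §9]
-/

set_option linter.dupNamespace false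

noncomputable section

open scoped Classical BigOperators

namespace Summit.BirchSwinnertonDyer.BirchSwinnertonDyer.Cruxes.KolyvaginPrimitiveAdditiveAbelianType.Birth

open WeierstrassCurve NumberField IsDedekindDomain Literature.NumberTheory.EllipticCurves
  Literature.NumberTheory.EllipticCurves.ModularForms
  Literature.NumberTheory.EllipticCurves.Rank1Residual
  Literature.NumberTheory.GaloisRepresentations
  Summit.BirchSwinnertonDyer.Rank1Residual
  Summit.BirchSwinnertonDyer.BirchSwinnertonDyer.Theorems.AdditiveKoly Module

/-! ## §1 The four stubs (ENGINE landed, cited by name in §2) -/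

/-- STUB P (v3, VERBATIM) — THE p-PARITY OF `Sel_p(E/K)` AT A ♯ ADDITIVE HOFFSTEIN–LUO FRAME: `#Sel_p(E/K) = p^s`
with `s` ODD. Not part of Kolyvagin's conjecture: `rank E(K) = 1` and `Ш(E/K)` finite [Gross–Zagier + Kolyvagin on
the frame: `r_an(E/K) = r_an(E) + r_an(E^{d_K}) = 1 + 0`], `dim_𝔽_p Ш(E/K)[p]` even [Cassels–Tate], `E(K)[p] = 0`
[`ρ̄` onto]; = Zhang Thm 9.2 ∕ the `p`-parity theorem. LANDED MODULO PUB: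
`Theorems.AdditiveKoly.oddSelmerRankAdditive_of_published` (p507430) ⟸ `gross_zagier`, `kolyvagin`,
`hasEntireLFunction_rat`, `exists_casselsTate_pairing`. [cite: WZhang2014, Thm. 9.2] -/
theorem stub_oddSelmerRankAdditive :
  ∀ (W : WeierstrassCurve ℚ) [W.IsElliptic] [W.IsGloballyMinimal] [NeZero (W.conductorNorm ℤ)]
    (p : ℕ) [Fact p.Prime] (K : Type) [Field K] [NumberField K]
    (Dt : ModularParametrizationData W (W.conductorNorm ℤ)) (β : ℤ) (ι : K →+* ℂ),
    5 ≤ p → Addv W p → W.HasSurjectiveModNGaloisRep p →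
    (∀ (ℓ : ℕ) [Fact ℓ.Prime], W.HasMultiplicativeReductionAtPrime ℓ →
      ¬ p ∣ padicValInt ℓ W.minimalDiscriminantInt) →
    (∃ (ℓ₁ ℓ₂ : ℕ) (_ : Fact ℓ₁.Prime) (_ : Fact ℓ₂.Prime), ℓ₁ ≠ ℓ₂ ∧
      W.HasMultiplicativeReductionAtPrime ℓ₁ ∧ W.HasMultiplicativeReductionAtPrime ℓ₂) →
    ¬ p ∣ W.tamagawaProduct → W.analyticRank = 1 →
    IsImaginaryQuadratic K → Odd (NumberField.discr K) →
    SatisfiesHeegnerHypothesis (W.conductorNorm ℤ) K →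
    (W.quadraticTwist (NumberField.discr K : ℚ)).entireLFunction 1 ≠ 0 →
    (4 * (W.conductorNorm ℤ : ℤ)) ∣ β ^ 2 - NumberField.discr K → ¬ (p : ℤ) ∣ Dt.c →
    ∃ s : ℕ, Odd s ∧ Nat.card (WeierstrassCurve.selmerGroup (W.baseChange K) (p : ℤ)) = p ^ s
    := by
  sorry

/-- STUB BC-v2 — KOLYVAGIN'S CONJECTURE MOD `p` IN `p`-SELMER RANK ONE AT AN ADDITIVE `p ≥ 5` OF
ABELIAN TYPE, WITNESS PINNED: at a ♯ additive Hoffstein–Luo frame with `SubM W p ∨ SubGord W p` and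
`#Sel_p(E/K) = p`, the conductor-`1` Kolyvagin–Heegner class `c(1) = δ(y_K)` is non-zero mod `p`. = the lead's v7
`stub_bottomRankOneAdditive` RESTRICTED to the abelian locus (= g3's v1 `stub_baseCaseAbelianType` with v7.1's
hypothesis order); mechanism-free as typed; to be re-cut S′ (twisted definite supply at an admissible `q`, W. Zhang
(4.8) multiplicity one for the semistable pair `(E ⊗ χ, χ_K)`) ∘ A′ (rank-0 anchor in toric currency) ∘ B′ (`χ_K`-twisted
first reciprocity). Why it might fail: A′ = the rank-0 BSD_p lower bound for `L(E/K, 1)` at an additive `p` is OPEN in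
print in every currency; for `e > 2` the conductor-`p` toric period needs a test-vector statement. NOT cheap from the crux or the parent (a witness `c(n) ≢ 0`
with `n ≠ 1` gives `c(1) ≢ 0` only through Kolyvagin's structure theorem). presearch: as g3's v1 (Keller–Yin
arXiv:2410.23241 Heegner pairs: vertical ∕ pot-ordinary only). [cite: WZhang2014, Thm. 9.1 with Thm. 7.2 and Thm. 4.1
(case r = 1), §7] [cite: arXiv:2410.23241, Prop. 3.1.3] [cite: GrossLMS1991, §4 (P_1 = y_K), Prop. 2.3] -/
theorem stub_baseCaseAbelianTypeV2 :
  ∀ (W : WeierstrassCurve ℚ) [W.IsElliptic] [W.IsGloballyMinimal] [NeZero (W.conductorNorm ℤ)]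
    (p : ℕ) [Fact p.Prime] (K : Type) [Field K] [NumberField K]
    (Dt : ModularParametrizationData W (W.conductorNorm ℤ)) (β : ℤ) (ι : K →+* ℂ),
    5 ≤ p → Addv W p →
    (Summit.BirchSwinnertonDyer.Rank1Residual.Additive.SubM W p ∨
      Summit.BirchSwinnertonDyer.Rank1Residual.Additive.SubGord W p) → W.HasSurjectiveModNGaloisRep p →
    (∀ (ℓ : ℕ) [Fact ℓ.Prime], W.HasMultiplicativeReductionAtPrime ℓ →
      ¬ p ∣ padicValInt ℓ W.minimalDiscriminantInt) →
    (∃ (ℓ₁ ℓ₂ : ℕ) (_ : Fact ℓ₁.Prime) (_ : Fact ℓ₂.Prime), ℓ₁ ≠ ℓ₂ ∧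
      W.HasMultiplicativeReductionAtPrime ℓ₁ ∧ W.HasMultiplicativeReductionAtPrime ℓ₂) →
    ¬ p ∣ W.tamagawaProduct → W.analyticRank = 1 →
    IsImaginaryQuadratic K → Odd (NumberField.discr K) →
    SatisfiesHeegnerHypothesis (W.conductorNorm ℤ) K →
    (W.quadraticTwist (NumberField.discr K : ℚ)).entireLFunction 1 ≠ 0 →
    (4 * (W.conductorNorm ℤ : ℤ)) ∣ β ^ 2 - NumberField.discr K → ¬ (p : ℤ) ∣ Dt.c →
    Nat.card (WeierstrassCurve.selmerGroup (W.baseChange K) (p : ℤ)) = p →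
    ∃ d : KolyvaginHeegnerData Dt β ι 1, d.kolyvaginClass (Fact.out : p.Prime) 1 ≠ 0
    := by
  sorry

/-- STUB KS-AB (v4) — W. ZHANG'S LEVEL KOLYVAGIN SYSTEMS AT AN ADDITIVE `p ≥ 5` OF ABELIAN TYPE (`SubM W p ∨ SubGord W p`: principal-series ∕ special local type, `e ∣ p − 1`) = the parent's v8 stub KS `stub_levelKolyvaginSystemsAdditive` with this child's type binder inserted after `Addv W p`, NOTHING ELSE
(RESIDUAL: the open mathematics of v6's S2 on this locus). On this locus every level-raised `g_n` untwists to the TAME BRANCH `g_n ⊗ ε̄` of level `p¹·M∏n` with nebentypus, where (A2)'s Ihara ∕ multiplicity-one input is the `Γ₁(p)`-with-character statement (not the `Γ₀(p²)`-anemic one refuted on (5, II*)) and (A5)'s anchor is the tame-branch rank-0 statement of the bottom BC-v2; the parent's type-free KS ⟸ KS-AB + KS-NA by `sub_exhaustive`. At every ♯ additive frame of this type, for complex conjugation `c ≠ 1` and the `ZMod p`-structure of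
`H¹(K, E[p])`, there is a `LevelKolyvaginSystemP W K p Dt β ι c` (tree `AdditiveKolyvaginRoadLevelSystems`, p523723):
classes `κ m n ∈ H¹(K, E[p])` for every finite set `n` of Bertolini–Darmon admissible primes and every finite set `m`
of Kolyvagin primes (Zhang's `c(∏m, ∏n)` on `X_{N∏n}` ∕ its Shimura set with `p² ∣ N`, transported to `H¹(K, E[p])`
by `A_n[𝔭_n] ≅ E[p]`), with: REALISATION at `n = ∅` (the frame's Kolyvagin classes mod `p`); at every NON-EMPTY
level the KOLYVAGIN-SYSTEM AXIOMS for the level-`n` structure [§8.1 property (1): sign; E's Kummer condition off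
`m ∪ n` (at `p² ∣ N` this includes ADDITIVE KUMMER-LINE RIGIDITY at `p`: the local conditions of `A_n` and `E` agree
in `H¹(K_𝔭, E[p])`); TORIC at `n`; TRANSVERSE at `m`; (8.1)]; (A2) congruence TRANSPORT along two steps [Thm 4.3:
BD05 reciprocity + Ihara ∕ multiplicity one at `p²`-level — type-preserving]; (A5) BASE CASE at non-empty even levels
of canonical rank one [Thm 7.2 for the level-raised `g_n` of the same additive type: the rank-0 anchor at infinite
slope + the first law]. NOT in print at `p² ∣ N` (Zhang §3, Thm 2.1, Thm 4.3, Thm 7.2 have `p ∤ N`); this is where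
the route's «why it might fail» lives (anchor = Skinner–Urban at infinite slope; type-preserving level raising;
Kummer lines at (p,e) ∈ {(5,4),(5,6),(7,6)}). presearch: none (route Novelty searches + this seat's: Keller–Yin
arXiv:2410.23241 is vertical ∕ pot-ordinary only). [cite: WZhang2014, §3.9 (3.30), §8.1, Thm. 2.1, Thm. 4.3,
Thm. 7.2, §9 proof of Thm. 9.1] [cite: BertoliniDarmon2005, Thm. 3.2, §9] -/
theorem stub_levelKolyvaginSystemsAbelianType :
  ∀ (W : WeierstrassCurve ℚ) [W.IsElliptic] [W.IsGloballyMinimal] [NeZero (W.conductorNorm ℤ)]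
    (p : ℕ) [Fact p.Prime] (K : Type) [Field K] [NumberField K]
    (Dt : ModularParametrizationData W (W.conductorNorm ℤ)) (β : ℤ) (ι : K →+* ℂ),
    5 ≤ p → Addv W p →
    (Summit.BirchSwinnertonDyer.Rank1Residual.Additive.SubM W p ∨
      Summit.BirchSwinnertonDyer.Rank1Residual.Additive.SubGord W p) → W.HasSurjectiveModNGaloisRep p →
    (∀ (ℓ : ℕ) [Fact ℓ.Prime], W.HasMultiplicativeReductionAtPrime ℓ →
      ¬ p ∣ padicValInt ℓ W.minimalDiscriminantInt) →
    (∃ (ℓ₁ ℓ₂ : ℕ) (_ : Fact ℓ₁.Prime) (_ : Fact ℓ₂.Prime), ℓ₁ ≠ ℓ₂ ∧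
      W.HasMultiplicativeReductionAtPrime ℓ₁ ∧ W.HasMultiplicativeReductionAtPrime ℓ₂) →
    ¬ p ∣ W.tamagawaProduct → W.analyticRank = 1 →
    IsImaginaryQuadratic K → Odd (NumberField.discr K) →
    SatisfiesHeegnerHypothesis (W.conductorNorm ℤ) K →
    (W.quadraticTwist (NumberField.discr K : ℚ)).entireLFunction 1 ≠ 0 →
    (4 * (W.conductorNorm ℤ : ℤ)) ∣ β ^ 2 - NumberField.discr K → ¬ (p : ℤ) ∣ Dt.c →
    ∀ (c : K ≃ₐ[ℚ] K), c ≠ 1 → ∀ [Module (ZMod p) (Vp W K p)],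
    Nonempty (LevelKolyvaginSystemP W K p Dt β ι c)
    := by
  sorry

/-- STUB LOC (v7) — THE LOCAL–GLOBAL PACKAGE AT THE PLACES OF `K` (E-SIDE, IN PRINT, PROVABLE). At every ♯ additive
frame, for `c ≠ 1` and the `ZMod p`-structures of `H¹(K, E[p])` and of the `H¹(K_v, E[p])`, there is a
`KolyvaginLocalPackageP W K p ι c` (tree `AdditiveKolyvaginRoadLocalPackage`, p527353): `ZMod p`-bilinear local forms
`b_v` with (REC) [Milne ADT I Thm 4.10: Poitou–Tate for the totally complex `K`; tree THEOREM
`poitouTate_sum_localTatePairing_eq_zero_of_isTotallyComplex`], isotropy of E's Kummer condition [Poonen–Rains 4.10;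
tree `kummerClass_cupProduct_kummerClass_eq_zero_holds`], of the TORIC condition above BD-admissible primes [Zhang
Prop 5.4; akr-p1 g2 `weilCupProduct_res_eq_zero_of_valued` + `natCard_augmentation_le_of_admQ`], of the TRANSVERSE
condition at Kolyvagin primes, (Perf) `H¹(K_λ, E[p]) = H¹_f ⊕ H¹_tr` with perfect eigen-lines and (Line) [Zhang §8.1,
L.8.1; Gross §4; `p = 3`: zhang3-p1 ∕ koly `…Method2Kolyvagin{TransverseIsotropy,Perf,Line,CupNonvanishing}`, to be
ported `3 ↦ p`], and (Supply) = Zhang's Lemma 8.2 for the level-`n` structure [E-side Poitou–Tate Euler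
characteristic; `p = 3`: `…ZhangSupply*`, in progress]. No level-raised object enters. presearch: Zhang L.8.1/8.2
[corpus: paper:doi-10-4310-cjm-2014-v2-n2-a2 §8], Milne ADT I.4.10 — in print for every odd `p`.
[cite: WZhang2014, §8.1, Lemma 8.1, Lemma 8.2, Prop. 5.4] [cite: MilneADT2006, Ch. I, Cor. 2.3, Thm. 4.10]
[cite: PoonenRains2012, Prop. 4.10] [cite: GrossLMS1991, §4] -/
theorem stub_kolyvaginLocalPackageAdditive :
  ∀ (W : WeierstrassCurve ℚ) [W.IsElliptic] [W.IsGloballyMinimal] [NeZero (W.conductorNorm ℤ)]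
    (p : ℕ) [Fact p.Prime] (K : Type) [Field K] [NumberField K]
    (Dt : ModularParametrizationData W (W.conductorNorm ℤ)) (β : ℤ) (ι : K →+* ℂ),
    5 ≤ p → Addv W p → W.HasSurjectiveModNGaloisRep p →
    (∀ (ℓ : ℕ) [Fact ℓ.Prime], W.HasMultiplicativeReductionAtPrime ℓ →
      ¬ p ∣ padicValInt ℓ W.minimalDiscriminantInt) →
    (∃ (ℓ₁ ℓ₂ : ℕ) (_ : Fact ℓ₁.Prime) (_ : Fact ℓ₂.Prime), ℓ₁ ≠ ℓ₂ ∧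
      W.HasMultiplicativeReductionAtPrime ℓ₁ ∧ W.HasMultiplicativeReductionAtPrime ℓ₂) →
    ¬ p ∣ W.tamagawaProduct → W.analyticRank = 1 →
    IsImaginaryQuadratic K → Odd (NumberField.discr K) →
    SatisfiesHeegnerHypothesis (W.conductorNorm ℤ) K →
    (W.quadraticTwist (NumberField.discr K : ℚ)).entireLFunction 1 ≠ 0 →
    (4 * (W.conductorNorm ℤ : ℤ)) ∣ β ^ 2 - NumberField.discr K → ¬ (p : ℤ) ∣ Dt.c →
    ∀ (c : K ≃ₐ[ℚ] K), c ≠ 1 → ∀ [Module (ZMod p) (Vp W K p)]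
      [∀ v : Place K, Module (ZMod p)
        (galoisCohomology (((W.baseChange K).torsionGaloisModule ((p ^ 1 : ℕ) : ℤ)).toLocal v) 1)],
    Nonempty (KolyvaginLocalPackageP W K p ι c)
    := by
  sorry

/-! ## §2 Derived: v6's S2 and v1's S1 are theorems -/

/-- v6's S2 `stub_inductionGivenRankLoweringAdditive` — NO LONGER A STUB: W. Zhang's induction above the bottom GIVEN
(A1) from KS (the level Kolyvagin systems exist), LOC (the local–global package) and ENGINE (the instantiated induction).
Conclusion text VERBATIM v6's, with the local `ZMod p`-structures as an extra instance binder (all such structures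
agree; `_of` supplies the canonical one). [cite: WZhang2014, §9 proof of Thm. 9.1] -/
theorem inductionGivenRankLowering_of :
  ∀ (W : WeierstrassCurve ℚ) [W.IsElliptic] [W.IsGloballyMinimal] [NeZero (W.conductorNorm ℤ)]
    (p : ℕ) [Fact p.Prime] (K : Type) [Field K] [NumberField K]
    (Dt : ModularParametrizationData W (W.conductorNorm ℤ)) (β : ℤ) (ι : K →+* ℂ),
    5 ≤ p → Addv W p →
    (Summit.BirchSwinnertonDyer.Rank1Residual.Additive.SubM W p ∨
      Summit.BirchSwinnertonDyer.Rank1Residual.Additive.SubGord W p) → W.HasSurjectiveModNGaloisRep p →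
    (∀ (ℓ : ℕ) [Fact ℓ.Prime], W.HasMultiplicativeReductionAtPrime ℓ →
      ¬ p ∣ padicValInt ℓ W.minimalDiscriminantInt) →
    (∃ (ℓ₁ ℓ₂ : ℕ) (_ : Fact ℓ₁.Prime) (_ : Fact ℓ₂.Prime), ℓ₁ ≠ ℓ₂ ∧
      W.HasMultiplicativeReductionAtPrime ℓ₁ ∧ W.HasMultiplicativeReductionAtPrime ℓ₂) →
    ¬ p ∣ W.tamagawaProduct → W.analyticRank = 1 →
    IsImaginaryQuadratic K → Odd (NumberField.discr K) →
    SatisfiesHeegnerHypothesis (W.conductorNorm ℤ) K →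
    (W.quadraticTwist (NumberField.discr K : ℚ)).entireLFunction 1 ≠ 0 →
    (4 * (W.conductorNorm ℤ : ℤ)) ∣ β ^ 2 - NumberField.discr K → ¬ (p : ℤ) ∣ Dt.c →
    ∀ (c : K ≃ₐ[ℚ] K), c ≠ 1 → ∀ [Module (ZMod p) (Vp W K p)]
      [∀ v : Place K, Module (ZMod p)
        (galoisCohomology (((W.baseChange K).torsionGaloisModule ((p ^ 1 : ℕ) : ℤ)).toLocal v) 1)],
      (∀ (n : Finset (AdmQ W K p)) (μ : Bool) (x : Vp W K p),
        x ∈ SelQP W K p c n μ → x ≠ 0 →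
        ∃ q : AdmQ W K p, q ∉ n ∧
          x ∉ SelQP W K p c (insert q n) μ ∧
          SelQP W K p c (insert q n) μ ≤ SelQP W K p c n μ ∧
          finrank (ZMod p) (SelQP W K p c (insert q n) μ) + 1 = finrank (ZMod p) (SelQP W K p c n μ) ∧
          SelQP W K p c (insert q n) (!μ) = SelQP W K p c n (!μ)) →
    ∀ (s : ℕ), Odd s → 3 ≤ s →
    Nat.card (WeierstrassCurve.selmerGroup (W.baseChange K) (p : ℤ)) = p ^ s →
    ∃ (n : ℕ) (d : KolyvaginHeegnerData Dt β ι n),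
      KolyvaginDescent.KolSupp (Zhang2014.IsKolyvaginPrime (W.conductorNorm ℤ) W K p) n ∧
        d.kolyvaginClass (Fact.out : p.Prime) 1 ≠ 0 := by
  intro W _ _ _ p _ K _ _ Dt β ι h5 hadd hty hsurj hsp1 hsp2 htam hr1 hK hodd hHH hL hβ hc c hc1 _ _ hA1 s hsodd h3 hs
  obtain ⟨S⟩ := stub_levelKolyvaginSystemsAbelianType W p K Dt β ι h5 hadd hty hsurj hsp1 hsp2 htam hr1 hK hodd hHH
    hL hβ hc c hc1
  obtain ⟨L⟩ := stub_kolyvaginLocalPackageAdditive W p K Dt β ι h5 hadd hsurj hsp1 hsp2 htam hr1 hK hodd hHH hL hβ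
    hc c hc1
  exact stub_inductionOfLevelSystemsAdditive W p K Dt β ι h5 hadd hsurj hsp1 hsp2 htam hr1 hK hodd hHH hL hβ hc c hc1
    hA1 S L s hsodd h3 hs

/-- Selmer rank one on the abelian locus: BC-v2 gives the pinned conductor-`1` witness, packaged with
`KolyvaginDescent.kolSupp_one` (v7's `selmerRankOne_of` with the type binder). -/
theorem selmerRankOneAbelian_of :
  ∀ (W : WeierstrassCurve ℚ) [W.IsElliptic] [W.IsGloballyMinimal] [NeZero (W.conductorNorm ℤ)]
    (p : ℕ) [Fact p.Prime] (K : Type) [Field K] [NumberField K]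
    (Dt : ModularParametrizationData W (W.conductorNorm ℤ)) (β : ℤ) (ι : K →+* ℂ),
    5 ≤ p → Nat.card (WeierstrassCurve.selmerGroup (W.baseChange K) (p : ℤ)) = p →
    Addv W p →
    (Summit.BirchSwinnertonDyer.Rank1Residual.Additive.SubM W p ∨
      Summit.BirchSwinnertonDyer.Rank1Residual.Additive.SubGord W p) → W.HasSurjectiveModNGaloisRep p →
    (∀ (ℓ : ℕ) [Fact ℓ.Prime], W.HasMultiplicativeReductionAtPrime ℓ →
      ¬ p ∣ padicValInt ℓ W.minimalDiscriminantInt) →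
    (∃ (ℓ₁ ℓ₂ : ℕ) (_ : Fact ℓ₁.Prime) (_ : Fact ℓ₂.Prime), ℓ₁ ≠ ℓ₂ ∧
      W.HasMultiplicativeReductionAtPrime ℓ₁ ∧ W.HasMultiplicativeReductionAtPrime ℓ₂) →
    ¬ p ∣ W.tamagawaProduct → W.analyticRank = 1 →
    IsImaginaryQuadratic K → Odd (NumberField.discr K) →
    SatisfiesHeegnerHypothesis (W.conductorNorm ℤ) K →
    (W.quadraticTwist (NumberField.discr K : ℚ)).entireLFunction 1 ≠ 0 →
    (4 * (W.conductorNorm ℤ : ℤ)) ∣ β ^ 2 - NumberField.discr K → ¬ (p : ℤ) ∣ Dt.c →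
    ∃ (n : ℕ) (d : KolyvaginHeegnerData Dt β ι n),
      KolyvaginDescent.KolSupp (Zhang2014.IsKolyvaginPrime (W.conductorNorm ℤ) W K p) n ∧
        d.kolyvaginClass (Fact.out : p.Prime) 1 ≠ 0 := by
  intro W _ _ _ p _ K _ _ Dt β ι h5 hsel hadd hty hsurj hsp1 hsp2 htam hr1 hK hodd hHH hL hβ hc
  obtain ⟨d, hd⟩ := stub_baseCaseAbelianTypeV2 W p K Dt β ι h5 hadd hty hsurj hsp1 hsp2 htam hr1 hK hodd hHH hL hβ hc
    hsel
  exact ⟨1, d, KolyvaginDescent.kolSupp_one _, hd⟩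

/-! ## §3 Composition -/

/-- Complex conjugation exists: an imaginary quadratic field has an automorphism `≠ 1` (`|Aut(K/ℚ)| = 2`).
[folklore] -/
theorem exists_algEquiv_ne_one (K : Type) [Field K] [NumberField K] (hK : IsImaginaryQuadratic K) :
    ∃ c : K ≃ₐ[ℚ] K, c ≠ 1 := by
  haveI : Algebra.IsQuadraticExtension ℚ K := ⟨hK.1⟩
  have hcard : Nat.card (K ≃ₐ[ℚ] K) = 2 := by rw [IsGalois.card_aut_eq_finrank, hK.1]
  haveI : Finite (K ≃ₐ[ℚ] K) := Nat.finite_of_card_ne_zero (by rw [hcard]; decide)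
  haveI : Nontrivial (K ≃ₐ[ℚ] K) := Finite.one_lt_card_iff_nontrivial.mp (by rw [hcard]; decide)
  exact exists_ne 1

/-- COMPOSITION (child v2 = v7.1's, type binder threaded): the stubs P, BC-v2, KS, LOC, ENGINE and the LANDED A1 give
the child decl BY NAME, by the PARITY CASE SPLIT on `#Sel_p(E/K) = p^s` (stub P): `s = 1` — BOT-NA with the pinned
`n = 1` witness (`selmerRankOneAbelian_of`) — or `s` odd `≥ 3` — complex conjugation, the `ZMod p`-structures, the
landed A1 at `c`, then KS ∘ LOC ∘ ENGINE (`inductionGivenRankLowering_of`, type-free). Sorry-free. -/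
theorem KolyvaginPrimitiveAdditiveAbelianType_of :
    Summit.BirchSwinnertonDyer.BirchSwinnertonDyer.Theses.AdditiveKolyvaginRoad.KolyvaginPrimitiveAdditiveAbelianType := by
  intro W _ _ _ p _ K _ _ Dt β ι h5 hadd hty hsurj hsp1 hsp2 htam hr1 hK hodd hHH hL hβ hc
  obtain ⟨s, hsodd, hs⟩ :=
    stub_oddSelmerRankAdditive W p K Dt β ι h5 hadd hsurj hsp1 hsp2 htam hr1 hK hodd hHH hL hβ hc
  by_cases h1 : s = 1
  · subst h1
    rw [pow_one] at hs
    exact selmerRankOneAbelian_of W p K Dt β ι h5 hs hadd hty hsurj hsp1 hsp2 htam hr1 hK hodd hHH hL hβ hc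
  · -- Selmer rank odd and `≠ 1`, hence `≥ 3`: Zhang's induction above the bottom, fed with (A1)
    have h3 : 3 ≤ s := by
      obtain ⟨k, hk⟩ := hsodd
      omega
    obtain ⟨c, hc1⟩ := exists_algEquiv_ne_one K hK
    -- the unique `ZMod p`-module structure on `H¹(K, E[p])`
    letI : Module (ZMod p) (Vp W K p) :=
      AddCommGroup.zmodModule (fun x ↦ by
        have h := zsmul_discreteH1_torsion ((p ^ 1 : ℕ) : ℤ) x
        rw [← natCast_zsmul]
        convert h using 2
        push_cast
        ring)
    -- the unique `ZMod p`-module structures on the `H¹(K_v, E[p])` (`p · H¹(K_v, E[p]) = 0`)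
    letI : ∀ v : Place K, Module (ZMod p)
        (galoisCohomology (((W.baseChange K).torsionGaloisModule ((p ^ 1 : ℕ) : ℤ)).toLocal v) 1) := fun v ↦
      AddCommGroup.zmodModule (fun x ↦ by
        have h := galoisCohomology.nsmul_eq_zero_of_forall
          (((W.baseChange K).torsionGaloisModule ((p ^ 1 : ℕ) : ℤ)).toLocal v) (n := p ^ 1)
          (fun m => AddSubgroup.torsionBy.nsmul m) x
        simpa using h)
    have hA1 := stub_rankLoweringAdditive W p K Dt β ι h5 hadd hsurj hsp1 hsp2 htam hr1 hK hodd hHH hL hβ hc c hc1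
    exact inductionGivenRankLowering_of W p K Dt β ι h5 hadd hty hsurj hsp1 hsp2 htam hr1 hK hodd hHH hL hβ hc c hc1
      hA1 s hsodd h3 hs

end Summit.BirchSwinnertonDyer.BirchSwinnertonDyer.Cruxes.KolyvaginPrimitiveAdditiveAbelianType.Birth

end
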